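import Summits.QuantumFields.BalabanUV.T4Continuum.Support.NE7CritClosed
import Summits.QuantumFields.BalabanUV.T4Continuum.Support.NE7ConvOneStepTangent
import Summits.QuantumFields.BalabanUV.T4Continuum.Support.MinimalActionWitness
import HarnessLib

/-!
# NE7OneStepOfPathOpen — THE JOINT END OF GEN 67: ONE-STEP ⇐ PATH ∧ OPEN ∧ REP_w — the flat datum is a free start for the continuity method
# (the flat configuration is admissible for the flat datum, radius `0`, and CRITICAL for every skew direction), F18 continues criticality to `V`,
# F19 turns criticality + representation into the global minimiser

Cell `pub-balaban`, rung (B)+1 sub-cell t4, lineage `b2b-balaban-t4-ne7-p1`, generation 67 (CRUX PROVER NE7 #1); hunt (h11), memo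
`t4/b2b-balaban-t4-ne7-p1-g67/HUNT-H11-NORMAL-CURRENCY.md` §3–§5.  File F20 (over F18 `NE7CritClosed`, F19 `NE7ConvOneStepTangent`, row NE3's `MinimalActionWitness`).

WHAT ([folklore]; 0 def, 0 sorry).
§1 THE FLAT START: `dAction_eq_zero_of_flat` ∕ `dAction_flatCfg` (a unitary configuration with all plaquette variables `1` is critical for EVERY skew
   direction — the dressed curl is skew, [tree] `AveragingDeficitTransport.curl_mem_skewAdjoint`, and `Re tr` of a skew matrix vanishes; `tanCritical_of_flat`), `flatCfg_mem_admissible` (it is admissible for the flat datum at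
   every level, [tree] `MinimalActionWitness.flatCfg_mem_sfClass` ∕ `avgIter_flatCfg`), `tanCritical_flatCfg` (so the `h0` of F18's continuity method holds
   at the flat datum with any radius `r ≥ 0`).
§2 **`oneStep_of_path_open_repW`** — the `hstep` binder of `NE7InteriorInduction.interior_exists_all_levels` (ONE-STEP at every level for the datum `V`)
   from: a data path `γ` continuous on `[0,1]` with `γ 1 = V` whose start `γ 0` carries, at every level, an admissible configuration with all plaquette
   variables `1` (PATH; `γ 0 = flatCfg` qualifies: `flatCfg_mem_admissible`); at every level (OPEN) (local continuation with the radius kept =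
   a-priori estimate with margin + IFT on the slice); at every level REP_w stated UNIVERSALLY (every admissible, `SmallField · (δ(L^{k+1})^{−2})`,
   tangent-critical `U♯` represents every admissible competitor with the weighted normal letters and F9's line); plus (P♮)_W, the `LevelSmall` family and
   the class smallness of `MinimalActionCompact`.  The competitor `U₀` of the binder is NOT USED: existence comes from the path.
§3 `oneStep_SU2_of_path_open_repW` ∕ `oneStep_SU3_of_path_open_repW` — `d = 4`, `L = 2`, `card n = 2 ∕ 3`, `0 < ε ≤ 10⁻⁵³`: (P♮)_W, the level family and the
   class smallness DISCHARGED (`classSlicePoincare_SU2'` ∕ `classSlicePoincare_SU3`, `levelSmall_all_d4_L2`, `norm_num` on `C₀ 4 = 226·320²`).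
   SO, FOR THE PROGRAMME's CASE: **ONE-STEP ⇐ [kernel] PATH ∧ OPEN ∧ REP_w** — three displayed letters, nothing else.
HONEST FRAMING (page 1).  Composition; PATH (a continuous path of data from the flat datum to `V` — for which data it exists is the almost-commuting
question of memo H11 §3), OPEN (ALL the hard analysis: the a-priori estimate of [Balaban1985Variational] Sect. F TYPE + the implicit-function continuation on
the slice with the smooth-preimage multiplier letter) and REP_w ([Balaban1985Variational] Prop. 2 ∕ B8 Thm 2 TYPE gauge-fixed chord + smooth-lift normal
sizes) are HYPOTHESES asserted for nothing; NOT ONE-STEP, NOT NE7; spine 0∕9; finite T⁴ rung (B)+1 — NOT infinite volume, NOT mass gap, NOT Clay.  Continuum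
YM on T⁴ ⇐ BetaPertH ∧ nine spine estimates (0/9 proved); BetaPertH ⇐ (D1) ∧ (D4) ∧ CAP+tail; G-an2-4 gates asym, D1 and NE2/3/4.
-/

set_option autoImplicit false

open scoped BigOperators Matrix Matrix.Norms.L2Operator Topology
open NormedSpace Finset Set Filter

namespace Summit.QuantumFields.BalabanUV.T4Continuum.NE7OneStepOfPathOpen

open Literature.MathematicalPhysics.QuantumFieldTheory.Balaban1983to89
open B7Prop1Explicit B7Prop2Explicit MatrixLog UnitaryModel
open T4AveragingDeficitWall (IsUnitaryCfg IsSkewDir SmallField vary curl curlSq dirSq fhol flat_mem_classes)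
open T4AveragingDeficitWallBoundary (IsPeriodicCfg periodBox)
open AveragingDeficitPeriodicCounting (IsPeriodicDir)
open AveragingDeficitTransport (curl_mem_skewAdjoint nReTr_eq_zero_of_mem_skewAdjoint)
open AveragingDeficitMultiLevelPrep (tower LevelSmall TangentIter)
open MinimalActionLevels (levelAction perWin)
open MinimalActionSandwich (IsMinimiser admissible)
open MinimalActionRate (sfClass)
open MinimalActionWitness (flatCfg fhol_flatCfg avgIter_flatCfg flatCfg_mem_sfClass)
open NE3HessForm (dAction)
open NE3SlicePoincareShape (SlicePoincare slicePoincare_mono)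
open NE3FrameFreeSliceW (frameFreeBlockLandauW)
open NE3EnergyWeightedShapes (energyNormW)
open NE3SlicePoincareBudgetLine (CPLine)
open NE3ClassRadiusFamily (classSlicePoincare_SU2' CPLine_nonneg CPLine_nonneg_d4_L2)
open NE7ConvOneStepSU2 (levelSmall_all_d4_L2)
open NE7ConvOneStepSU3 (classSlicePoincare_SU3)
open NE7CritClosed (critOneStep_tan_of_continuity)
open NE7ConvOneStepTangent (isMinimiser_of_tanCritical_repW_class)

noncomputable section

variable {d : ℕ} {n : Type*} [Fintype n] [DecidableEq n]

/-! ## §1 The flat start -/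

/-- **A FLAT UNITARY CONFIGURATION IS CRITICAL FOR EVERY SKEW DIRECTION**: if every plaquette variable of `U` is `1` (`SmallField U 0`) then
`dAction U φ W = 0` for skew `φ` (the dressed curl is skew, `Re tr` of a skew matrix is `0`). [folklore] -/
theorem dAction_eq_zero_of_flat [Nonempty n] {U : Site d → Fin d → (Matrix n n ℂ)ˣ} (hU : IsUnitaryCfg U) (hflat : SmallField U 0)
    {φ : Site d → Fin d → Matrix n n ℂ} (hφ : IsSkewDir φ) (W : Finset (T4AveragingDeficitWall.Plaq d)) : dAction U φ W = 0 := by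
  unfold dAction
  rw [neg_eq_zero]
  refine Finset.sum_eq_zero fun p _ => ?_
  have h1 : ((fhol U p : (Matrix n n ℂ)ˣ) : Matrix n n ℂ) = 1 := by
    have h := hflat p.1 p.2.1.1 p.2.1.2 (ne_of_lt p.2.2)
    have h' : ‖((fhol U p : (Matrix n n ℂ)ˣ) : Matrix n n ℂ) - 1‖ ≤ 0 := h
    exact sub_eq_zero.mp (norm_le_zero_iff.mp h')
  rw [h1, mul_one]
  exact nReTr_eq_zero_of_mem_skewAdjoint (curl_mem_skewAdjoint hU hφ p)

/-- **THE FLAT CONFIGURATION IS CRITICAL FOR EVERY SKEW DIRECTION**: `dAction flatCfg φ W = 0`. [folklore] -/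
theorem dAction_flatCfg [Nonempty n] {φ : Site d → Fin d → Matrix n n ℂ} (hφ : IsSkewDir φ) (W : Finset (T4AveragingDeficitWall.Plaq d)) :
    dAction (flatCfg : Site d → Fin d → (Matrix n n ℂ)ˣ) φ W = 0 :=
  dAction_eq_zero_of_flat (flat_mem_classes (d := d) (n := n) le_rfl).1 (flat_mem_classes (d := d) (n := n) le_rfl).2 hφ W

/-- **CRIT AT A DATUM CARRYING A FLAT ADMISSIBLE CONFIGURATION, FOR FREE**: a unitary admissible `U₀` all of whose plaquette variables are `1` (e.g. a
constant commuting configuration over a constant commuting datum, or a periodic pure gauge) is `SmallField · r` for every `r ≥ 0` and critical on all skew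
directions. [folklore] -/
theorem tanCritical_of_flat [Nonempty n] {L N k : ℕ} {ε r : ℝ} (hr : 0 ≤ r) {V₀ U₀ : Site d → Fin d → (Matrix n n ℂ)ˣ}
    (hU₀ : U₀ ∈ admissible (sfClass d L N ε) L (k + 1) V₀) (hflat : SmallField U₀ 0) :
    ∃ U : Site d → Fin d → (Matrix n n ℂ)ˣ, U ∈ admissible (sfClass d L N ε) L (k + 1) V₀ ∧ SmallField U r ∧
      ∀ φ : Site d → Fin d → Matrix n n ℂ, IsSkewDir φ → IsPeriodicDir φ ((N * L ^ (k + 1) : ℕ) : ℤ) → TangentIter L k U φ →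
        dAction U φ (perWin d (N * L ^ (k + 1))) = 0 :=
  ⟨U₀, hU₀, MinimalActionRate.SmallField.mono hflat hr, fun _ hφ _ _ => dAction_eq_zero_of_flat hU₀.1.1 hflat hφ _⟩

/-- The flat configuration is admissible for the flat datum at every level of `sfClass d L N ε` (`ε ≥ 0`). [folklore] -/
theorem flatCfg_mem_admissible [Nonempty n] (L N : ℕ) {ε : ℝ} (hε : 0 ≤ ε) (j : ℕ) :
    (flatCfg : Site d → Fin d → (Matrix n n ℂ)ˣ) ∈ admissible (sfClass d L N ε) L j flatCfg :=
  ⟨flatCfg_mem_sfClass L N hε j, avgIter_flatCfg L j⟩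

/-- **CRIT AT THE FLAT DATUM, FOR FREE**: the flat configuration is admissible for the flat datum, `SmallField · r` for every `r ≥ 0`, and critical on the
tangent space (indeed on all skew directions). [folklore] -/
theorem tanCritical_flatCfg [Nonempty n] (L N k : ℕ) {ε r : ℝ} (hε : 0 ≤ ε) (hr : 0 ≤ r) :
    ∃ U : Site d → Fin d → (Matrix n n ℂ)ˣ, U ∈ admissible (sfClass d L N ε) L (k + 1) flatCfg ∧ SmallField U r ∧
      ∀ φ : Site d → Fin d → Matrix n n ℂ, IsSkewDir φ → IsPeriodicDir φ ((N * L ^ (k + 1) : ℕ) : ℤ) → TangentIter L k U φ →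
        dAction U φ (perWin d (N * L ^ (k + 1))) = 0 :=
  ⟨flatCfg, flatCfg_mem_admissible L N hε (k + 1), (flat_mem_classes (d := d) (n := n) hr).2, fun _ hφ _ _ => dAction_flatCfg hφ _⟩

/-! ## §2 ONE-STEP from PATH ∧ OPEN ∧ REP_w -/

/-- **ONE-STEP ⇐ PATH ∧ OPEN ∧ REP_w** (generic `d`, `L ≥ 2`, `N ≥ 1`; class smallness `16C₀ε ≤ 3`, `1024(d+1)(d+4)L²ε ≤ 1`; `LevelSmall` family; (P♮)_W with
constant `CP`).  See the module docstring, §2.  The competitor of the binder is unused. [folklore] -/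
theorem oneStep_of_path_open_repW [Nonempty n] {L N : ℕ} [NeZero L] [NeZero N] (hL : 2 ≤ L) (hN : 1 ≤ N) {ε δ CP : ℝ} (hε0 : 0 ≤ ε)
    (hε1 : 16 * C0 d * ε ≤ 3) (hε2 : 1024 * (d + 1) * (d + 4) * (L : ℝ) ^ 2 * ε ≤ 1) (hδ : 0 ≤ δ) (hCP : 0 < CP)
    (hls : ∀ k : ℕ, LevelSmall d L k (ε / ((L : ℝ) ^ (k + 1)) ^ 2))
    (hP : ∀ (j : ℕ) (W : Site d → Fin d → (Matrix n n ℂ)ˣ), W ∈ sfClass d L N ε (j + 1) →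
      SlicePoincare L (j + 1) W (frameFreeBlockLandauW L N (j + 1) W) CP (periodBox (d := d) (N * L ^ (j + 1))))
    {V : Site d → Fin d → (Matrix n n ℂ)ˣ} (γ : ℝ → (Site d → Fin d → (Matrix n n ℂ)ˣ)) (hγ : ContinuousOn γ (Icc (0 : ℝ) 1))
    (h0 : ∀ k : ℕ, ∃ U₀ : Site d → Fin d → (Matrix n n ℂ)ˣ, U₀ ∈ admissible (sfClass d L N ε) L (k + 1) (γ 0) ∧ SmallField U₀ 0)
    (hγ1 : γ 1 = V)
    (hopen : ∀ (k : ℕ), ∀ τ₀ ∈ Icc (0 : ℝ) 1,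
      (∃ U : Site d → Fin d → (Matrix n n ℂ)ˣ, U ∈ admissible (sfClass d L N ε) L (k + 1) (γ τ₀) ∧ SmallField U (δ / ((L : ℝ) ^ (k + 1)) ^ 2) ∧
        ∀ φ : Site d → Fin d → Matrix n n ℂ, IsSkewDir φ → IsPeriodicDir φ ((N * L ^ (k + 1) : ℕ) : ℤ) → TangentIter L k U φ →
          dAction U φ (perWin d (N * L ^ (k + 1))) = 0) →
      ∃ ρ : ℝ, 0 < ρ ∧ ∀ τ ∈ Icc (0 : ℝ) 1, |τ - τ₀| < ρ →
        ∃ U : Site d → Fin d → (Matrix n n ℂ)ˣ, U ∈ admissible (sfClass d L N ε) L (k + 1) (γ τ) ∧ SmallField U (δ / ((L : ℝ) ^ (k + 1)) ^ 2) ∧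
          ∀ φ : Site d → Fin d → Matrix n n ℂ, IsSkewDir φ → IsPeriodicDir φ ((N * L ^ (k + 1) : ℕ) : ℤ) → TangentIter L k U φ →
            dAction U φ (perWin d (N * L ^ (k + 1))) = 0)
    (hrepU : ∀ (k : ℕ) (Us : Site d → Fin d → (Matrix n n ℂ)ˣ), Us ∈ admissible (sfClass d L N ε) L (k + 1) V →
      SmallField Us (δ / ((L : ℝ) ^ (k + 1)) ^ 2) →
      (∀ φ : Site d → Fin d → Matrix n n ℂ, IsSkewDir φ → IsPeriodicDir φ ((N * L ^ (k + 1) : ℕ) : ℤ) → TangentIter L k Us φ →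
        dAction Us φ (perWin d (N * L ^ (k + 1))) = 0) →
      ∀ U' ∈ admissible (sfClass d L N ε) L (k + 1) V, ∃ (X XT XN : Site d → Fin d → Matrix n n ℂ) (α ν κ₁ : ℝ),
        IsSkewDir X ∧ IsPeriodicDir X ((N * L ^ (k + 1) : ℕ) : ℤ) ∧ 0 ≤ α ∧ (∀ x μ, ‖X x μ‖ ≤ α) ∧
        levelAction d L N (k + 1) (vary Us X 1) ≤ levelAction d L N (k + 1) U' ∧
        SmallField (vary Us X 1) (ε / ((L : ℝ) ^ (k + 1)) ^ 2) ∧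
        X = XT + XN ∧ XT ∈ frameFreeBlockLandauW (d := d) (n := n) L N (k + 1) Us ∧ IsSkewDir XN ∧ 0 ≤ ν ∧
        energyNormW L (k + 1) Us XN (periodBox (d := d) (N * L ^ (k + 1)))
          ≤ ν * energyNormW L (k + 1) Us X (periodBox (d := d) (N * L ^ (k + 1))) ∧
        ε / ((L : ℝ) ^ (k + 1)) ^ 2 * (∑ p ∈ perWin d (N * L ^ (k + 1)), ‖curl Us XN p‖)
          ≤ κ₁ * energyNormW L (k + 1) Us X (periodBox (d := d) (N * L ^ (k + 1))) ^ 2 ∧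
        2 * κ₁ ≤ ((((1 / 2 - ν ^ 2) / (2 * (1 + CP)) - ν ^ 2) / 2
            - 576 * d * (Real.exp α - 1) ^ 2 * ((L : ℝ) ^ (k + 1)) ^ 2) / (Fintype.card n : ℝ)
            - 28 * d * (ε / ((L : ℝ) ^ (k + 1)) ^ 2 + 7 * α ^ 2) * ((L : ℝ) ^ (k + 1)) ^ 2)) :
    ∀ (k : ℕ) (U₀ : Site d → Fin d → (Matrix n n ℂ)ˣ), U₀ ∈ admissible (sfClass d L N ε) L (k + 1) V →
      SmallField U₀ (δ / ((L : ℝ) ^ k) ^ 2) →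
      ∃ U, IsMinimiser d (sfClass d L N ε) L N (k + 1) V U ∧ SmallField U (δ / ((L : ℝ) ^ (k + 1)) ^ 2) := by
  have hL1 : 1 ≤ L := by omega
  intro k _ _ _
  have hr : 0 ≤ δ / ((L : ℝ) ^ (k + 1)) ^ 2 := by positivity
  obtain ⟨U₀, hU₀, hfl⟩ := h0 k
  have h0' := tanCritical_of_flat (r := δ / ((L : ℝ) ^ (k + 1)) ^ 2) hr hU₀ hfl
  obtain ⟨Us, hmem, hUsr, hcritT⟩ :=
    critOneStep_tan_of_continuity hL hε0 hε1 hε2 (hls k) γ hγ h0' (hopen k) 1 ⟨zero_le_one, le_rfl⟩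
  rw [hγ1] at hmem
  exact ⟨Us, isMinimiser_of_tanCritical_repW_class hL1 hN hε0 hCP hP hmem hcritT (hrepU k Us hmem hUsr hcritT), hUsr⟩

/-! ## §3 The programme's case `d = 4`, `L = 2`: SU(2) ∕ U(2) and SU(3) ∕ U(3) -/

/-- The class smallness of `MinimalActionCompact` at `d = 4`, `L = 2` from `ε ≤ 10⁻⁵³` (`C₀ 4 = 226·320²`). [folklore] -/
theorem classSmall_d4_L2 {ε : ℝ} (hε' : ε ≤ 1 / 10 ^ 53) :
    16 * C0 4 * ε ≤ 3 ∧ 1024 * ((4 : ℕ) + 1) * ((4 : ℕ) + 4) * (((2 : ℕ) : ℝ)) ^ 2 * ε ≤ 1 := by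
  unfold C0
  constructor <;> · norm_num at hε' ⊢; nlinarith

/-- **ONE-STEP AT `d = 4`, `L = 2`, SU(2)∕U(2) (`card n = 2`), `0 < ε ≤ 10⁻⁵³`, `0 ≤ δ`, FROM PATH ∧ OPEN ∧ REP_w ONLY** (the path starts at a datum with
flat admissible lifts, e.g. `flatCfg`).  See the module docstring, §3.
[folklore] -/
theorem oneStep_SU2_of_path_open_repW [Nonempty n] (hn : Fintype.card n = 2) {N : ℕ} [NeZero N] (hN : 1 ≤ N) {ε δ : ℝ} (hε : 0 < ε)
    (hε' : ε ≤ 1 / 10 ^ 53) (hδ : 0 ≤ δ) {V : Site 4 → Fin 4 → (Matrix n n ℂ)ˣ}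
    (γ : ℝ → (Site 4 → Fin 4 → (Matrix n n ℂ)ˣ)) (hγ : ContinuousOn γ (Icc (0 : ℝ) 1))
    (h0 : ∀ k : ℕ, ∃ U₀ : Site 4 → Fin 4 → (Matrix n n ℂ)ˣ, U₀ ∈ admissible (sfClass 4 2 N ε) 2 (k + 1) (γ 0) ∧ SmallField U₀ 0) (hγ1 : γ 1 = V)
    (hopen : ∀ (k : ℕ), ∀ τ₀ ∈ Icc (0 : ℝ) 1,
      (∃ U : Site 4 → Fin 4 → (Matrix n n ℂ)ˣ, U ∈ admissible (sfClass 4 2 N ε) 2 (k + 1) (γ τ₀) ∧ SmallField U (δ / (((2 : ℕ) : ℝ) ^ (k + 1)) ^ 2) ∧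
        ∀ φ : Site 4 → Fin 4 → Matrix n n ℂ, IsSkewDir φ → IsPeriodicDir φ ((N * 2 ^ (k + 1) : ℕ) : ℤ) → TangentIter 2 k U φ →
          dAction U φ (perWin 4 (N * 2 ^ (k + 1))) = 0) →
      ∃ ρ : ℝ, 0 < ρ ∧ ∀ τ ∈ Icc (0 : ℝ) 1, |τ - τ₀| < ρ →
        ∃ U : Site 4 → Fin 4 → (Matrix n n ℂ)ˣ, U ∈ admissible (sfClass 4 2 N ε) 2 (k + 1) (γ τ) ∧ SmallField U (δ / (((2 : ℕ) : ℝ) ^ (k + 1)) ^ 2) ∧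
          ∀ φ : Site 4 → Fin 4 → Matrix n n ℂ, IsSkewDir φ → IsPeriodicDir φ ((N * 2 ^ (k + 1) : ℕ) : ℤ) → TangentIter 2 k U φ →
            dAction U φ (perWin 4 (N * 2 ^ (k + 1))) = 0)
    (hrepU : ∀ (k : ℕ) (Us : Site 4 → Fin 4 → (Matrix n n ℂ)ˣ), Us ∈ admissible (sfClass 4 2 N ε) 2 (k + 1) V →
      SmallField Us (δ / (((2 : ℕ) : ℝ) ^ (k + 1)) ^ 2) →
      (∀ φ : Site 4 → Fin 4 → Matrix n n ℂ, IsSkewDir φ → IsPeriodicDir φ ((N * 2 ^ (k + 1) : ℕ) : ℤ) → TangentIter 2 k Us φ →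
        dAction Us φ (perWin 4 (N * 2 ^ (k + 1))) = 0) →
      ∀ U' ∈ admissible (sfClass 4 2 N ε) 2 (k + 1) V, ∃ (X XT XN : Site 4 → Fin 4 → Matrix n n ℂ) (α ν κ₁ : ℝ),
        IsSkewDir X ∧ IsPeriodicDir X ((N * 2 ^ (k + 1) : ℕ) : ℤ) ∧ 0 ≤ α ∧ (∀ x μ, ‖X x μ‖ ≤ α) ∧
        levelAction 4 2 N (k + 1) (vary Us X 1) ≤ levelAction 4 2 N (k + 1) U' ∧
        SmallField (vary Us X 1) (ε / (((2 : ℕ) : ℝ) ^ (k + 1)) ^ 2) ∧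
        X = XT + XN ∧ XT ∈ frameFreeBlockLandauW (d := 4) (n := n) 2 N (k + 1) Us ∧ IsSkewDir XN ∧ 0 ≤ ν ∧
        energyNormW 2 (k + 1) Us XN (periodBox (d := 4) (N * 2 ^ (k + 1)))
          ≤ ν * energyNormW 2 (k + 1) Us X (periodBox (d := 4) (N * 2 ^ (k + 1))) ∧
        ε / (((2 : ℕ) : ℝ) ^ (k + 1)) ^ 2 * (∑ p ∈ perWin 4 (N * 2 ^ (k + 1)), ‖curl Us XN p‖)
          ≤ κ₁ * energyNormW 2 (k + 1) Us X (periodBox (d := 4) (N * 2 ^ (k + 1))) ^ 2 ∧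
        2 * κ₁ ≤ ((((1 / 2 - ν ^ 2) / (2 * (1 + (CPLine 4 2 2 (1 / 10 ^ 17) (1 / 10 ^ 53) + 1))) - ν ^ 2) / 2
            - 576 * (4 : ℕ) * (Real.exp α - 1) ^ 2 * ((((2 : ℕ) : ℝ)) ^ (k + 1)) ^ 2) / (Fintype.card n : ℝ)
            - 28 * (4 : ℕ) * (ε / (((2 : ℕ) : ℝ) ^ (k + 1)) ^ 2 + 7 * α ^ 2) * ((((2 : ℕ) : ℝ)) ^ (k + 1)) ^ 2)) :
    ∀ (k : ℕ) (U₀ : Site 4 → Fin 4 → (Matrix n n ℂ)ˣ), U₀ ∈ admissible (sfClass 4 2 N ε) 2 (k + 1) V →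
      SmallField U₀ (δ / (((2 : ℕ) : ℝ) ^ k) ^ 2) →
      ∃ U, IsMinimiser 4 (sfClass 4 2 N ε) 2 N (k + 1) V U ∧ SmallField U (δ / (((2 : ℕ) : ℝ) ^ (k + 1)) ^ 2) := by
  have hP0 := classSlicePoincare_SU2' (n := n) hn hN hε hε'
  have hCP : 0 < CPLine 4 2 2 (1 / 10 ^ 17) (1 / 10 ^ 53) + 1 := by linarith [CPLine_nonneg_d4_L2]
  have hP : ∀ (j : ℕ) (W : Site 4 → Fin 4 → (Matrix n n ℂ)ˣ), W ∈ sfClass 4 2 N ε (j + 1) →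
      SlicePoincare 2 (j + 1) W (frameFreeBlockLandauW 2 N (j + 1) W) (CPLine 4 2 2 (1 / 10 ^ 17) (1 / 10 ^ 53) + 1)
        (periodBox (d := 4) (N * 2 ^ (j + 1))) :=
    fun j W hW => slicePoincare_mono (hP0 j W hW) (by linarith)
  have hls := levelSmall_all_d4_L2 hε.le (hε'.trans (by norm_num))
  obtain ⟨hε1, hε2⟩ := classSmall_d4_L2 hε'
  exact oneStep_of_path_open_repW (d := 4) (by norm_num) hN hε.le hε1 hε2 hδ hCP hls hP γ hγ h0 hγ1 hopen hrepU

/-- **ONE-STEP AT `d = 4`, `L = 2`, SU(3)∕U(3) (`card n = 3`), `0 < ε ≤ 10⁻⁵³`, `0 ≤ δ`, FROM PATH ∧ OPEN ∧ REP_w ONLY** (the path starts at a datum with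
flat admissible lifts, e.g. `flatCfg`).  See the module docstring, §3.
[folklore] -/
theorem oneStep_SU3_of_path_open_repW [Nonempty n] (hn : Fintype.card n = 3) {N : ℕ} [NeZero N] (hN : 1 ≤ N) {ε δ : ℝ} (hε : 0 < ε)
    (hε' : ε ≤ 1 / 10 ^ 53) (hδ : 0 ≤ δ) {V : Site 4 → Fin 4 → (Matrix n n ℂ)ˣ}
    (γ : ℝ → (Site 4 → Fin 4 → (Matrix n n ℂ)ˣ)) (hγ : ContinuousOn γ (Icc (0 : ℝ) 1))
    (h0 : ∀ k : ℕ, ∃ U₀ : Site 4 → Fin 4 → (Matrix n n ℂ)ˣ, U₀ ∈ admissible (sfClass 4 2 N ε) 2 (k + 1) (γ 0) ∧ SmallField U₀ 0) (hγ1 : γ 1 = V)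
    (hopen : ∀ (k : ℕ), ∀ τ₀ ∈ Icc (0 : ℝ) 1,
      (∃ U : Site 4 → Fin 4 → (Matrix n n ℂ)ˣ, U ∈ admissible (sfClass 4 2 N ε) 2 (k + 1) (γ τ₀) ∧ SmallField U (δ / (((2 : ℕ) : ℝ) ^ (k + 1)) ^ 2) ∧
        ∀ φ : Site 4 → Fin 4 → Matrix n n ℂ, IsSkewDir φ → IsPeriodicDir φ ((N * 2 ^ (k + 1) : ℕ) : ℤ) → TangentIter 2 k U φ →
          dAction U φ (perWin 4 (N * 2 ^ (k + 1))) = 0) →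
      ∃ ρ : ℝ, 0 < ρ ∧ ∀ τ ∈ Icc (0 : ℝ) 1, |τ - τ₀| < ρ →
        ∃ U : Site 4 → Fin 4 → (Matrix n n ℂ)ˣ, U ∈ admissible (sfClass 4 2 N ε) 2 (k + 1) (γ τ) ∧ SmallField U (δ / (((2 : ℕ) : ℝ) ^ (k + 1)) ^ 2) ∧
          ∀ φ : Site 4 → Fin 4 → Matrix n n ℂ, IsSkewDir φ → IsPeriodicDir φ ((N * 2 ^ (k + 1) : ℕ) : ℤ) → TangentIter 2 k U φ →
            dAction U φ (perWin 4 (N * 2 ^ (k + 1))) = 0)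
    (hrepU : ∀ (k : ℕ) (Us : Site 4 → Fin 4 → (Matrix n n ℂ)ˣ), Us ∈ admissible (sfClass 4 2 N ε) 2 (k + 1) V →
      SmallField Us (δ / (((2 : ℕ) : ℝ) ^ (k + 1)) ^ 2) →
      (∀ φ : Site 4 → Fin 4 → Matrix n n ℂ, IsSkewDir φ → IsPeriodicDir φ ((N * 2 ^ (k + 1) : ℕ) : ℤ) → TangentIter 2 k Us φ →
        dAction Us φ (perWin 4 (N * 2 ^ (k + 1))) = 0) →
      ∀ U' ∈ admissible (sfClass 4 2 N ε) 2 (k + 1) V, ∃ (X XT XN : Site 4 → Fin 4 → Matrix n n ℂ) (α ν κ₁ : ℝ),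
        IsSkewDir X ∧ IsPeriodicDir X ((N * 2 ^ (k + 1) : ℕ) : ℤ) ∧ 0 ≤ α ∧ (∀ x μ, ‖X x μ‖ ≤ α) ∧
        levelAction 4 2 N (k + 1) (vary Us X 1) ≤ levelAction 4 2 N (k + 1) U' ∧
        SmallField (vary Us X 1) (ε / (((2 : ℕ) : ℝ) ^ (k + 1)) ^ 2) ∧
        X = XT + XN ∧ XT ∈ frameFreeBlockLandauW (d := 4) (n := n) 2 N (k + 1) Us ∧ IsSkewDir XN ∧ 0 ≤ ν ∧
        energyNormW 2 (k + 1) Us XN (periodBox (d := 4) (N * 2 ^ (k + 1)))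
          ≤ ν * energyNormW 2 (k + 1) Us X (periodBox (d := 4) (N * 2 ^ (k + 1))) ∧
        ε / (((2 : ℕ) : ℝ) ^ (k + 1)) ^ 2 * (∑ p ∈ perWin 4 (N * 2 ^ (k + 1)), ‖curl Us XN p‖)
          ≤ κ₁ * energyNormW 2 (k + 1) Us X (periodBox (d := 4) (N * 2 ^ (k + 1))) ^ 2 ∧
        2 * κ₁ ≤ ((((1 / 2 - ν ^ 2) / (2 * (1 + (CPLine 4 2 3 (1 / 10 ^ 17) (1 / 10 ^ 53) + 1))) - ν ^ 2) / 2
            - 576 * (4 : ℕ) * (Real.exp α - 1) ^ 2 * ((((2 : ℕ) : ℝ)) ^ (k + 1)) ^ 2) / (Fintype.card n : ℝ)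
            - 28 * (4 : ℕ) * (ε / (((2 : ℕ) : ℝ) ^ (k + 1)) ^ 2 + 7 * α ^ 2) * ((((2 : ℕ) : ℝ)) ^ (k + 1)) ^ 2)) :
    ∀ (k : ℕ) (U₀ : Site 4 → Fin 4 → (Matrix n n ℂ)ˣ), U₀ ∈ admissible (sfClass 4 2 N ε) 2 (k + 1) V →
      SmallField U₀ (δ / (((2 : ℕ) : ℝ) ^ k) ^ 2) →
      ∃ U, IsMinimiser 4 (sfClass 4 2 N ε) 2 N (k + 1) V U ∧ SmallField U (δ / (((2 : ℕ) : ℝ) ^ (k + 1)) ^ 2) := by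
  have hP0 := classSlicePoincare_SU3 (n := n) hn hN hε hε'
  have hCP0 : 0 ≤ CPLine 4 2 3 (1 / 10 ^ 17) (1 / 10 ^ 53) := CPLine_nonneg (by norm_num) (by norm_num) (by norm_num) (by norm_num)
  have hCP : 0 < CPLine 4 2 3 (1 / 10 ^ 17) (1 / 10 ^ 53) + 1 := by linarith
  have hP : ∀ (j : ℕ) (W : Site 4 → Fin 4 → (Matrix n n ℂ)ˣ), W ∈ sfClass 4 2 N ε (j + 1) →
      SlicePoincare 2 (j + 1) W (frameFreeBlockLandauW 2 N (j + 1) W) (CPLine 4 2 3 (1 / 10 ^ 17) (1 / 10 ^ 53) + 1)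
        (periodBox (d := 4) (N * 2 ^ (j + 1))) :=
    fun j W hW => slicePoincare_mono (hP0 j W hW) (by linarith)
  have hls := levelSmall_all_d4_L2 hε.le (hε'.trans (by norm_num))
  obtain ⟨hε1, hε2⟩ := classSmall_d4_L2 hε'
  exact oneStep_of_path_open_repW (d := 4) (by norm_num) hN hε.le hε1 hε2 hδ hCP hls hP γ hγ h0 hγ1 hopen hrepU

end

end Summit.QuantumFields.BalabanUV.T4Continuum.NE7OneStepOfPathOpen
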